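import Mathlib.MeasureTheory.Function.L2Space
import Mathlib.MeasureTheory.Integral.Prod
import Literature.Analysis.FunctionSpaces.SpaceTimeWeakCompactness
import Summits.AnomalousDissipation.AnomalousDissipation.Theorems.TwoAndHalfDTwohalfdNegCondensateWeakLimit
import HarnessLib

/-!
# Stub `stub_rcWeakLimit` (RC-WL) of the line `log-kantorovich-enstrophy-transfer`
# (crux `TwoAndHalfD.TwohalfdNeg`, stmt-AnomalousDissipation-0211; regular-condensate theorem)

Sorry-free discharge of the registered stub `stub_rcWeakLimit` ("joint weak `L²` compactness on a
block") of the regular-condensate theorem of lead c7 (block architecture: good blocks → restart →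
Arzelà–Ascoli + weak `L²` limits → the limit solves the sourced transport equation → `κ = 0`
conservative balance → ODE endgame). This file is the weak-`L²`-limit step.

**Statement.** Let `μ := (vol|_(0,S)) ⊗ vol` on `ℝ × T²` (`S > 0`). Let `ϑ k : ℝ → T² → ℝ` have
`μ`-a.e. strongly measurable uncurrying, `∫ ϑ_k² dμ ≤ C` and `∫ ϑ_k(t)² ≤ C₁` for a.e.
`t ∈ (0,S)`, and let `ϑ₀ k ∈ L²(T²)` with `∫ ϑ₀_k² ≤ C₀`. Then along ONE common subsequence `φ`
there are `Θ : ℝ → T² → ℝ` (measurable uncurrying, `∫ Θ² dμ ≤ C`, `∫ Θ(t)² ≤ C₁` for a.e. `t`)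
and `Θ₀ ∈ L²(T²)` (`∫ Θ₀² ≤ C₀`) with `∫ ϑ_{φ n} G dμ → ∫ Θ G dμ` for every bounded `μ`-a.e.
strongly measurable `G` and `∫ ϑ₀_{φ n} w → ∫ Θ₀ w` for every `w ∈ L²(T²)`.

**Proof.** Space–time part (`rcWeakLimit_spaceTime`): the tree's function-level weak-* compactness
theorem `Literature.Analysis.FunctionSpaces.Torus.exists_strictMono_weakLimit_of_lintegral_sq_le`
(Brezis 2011, Cor. 3.30; bounded sequences of the separable Hilbert space `L²(μ)`, slice bound by
testing on `B × T²`) gives `φ₁`, the field `Θ` with the a.e. slice bound, and the convergence of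
pairings against every `G ∈ L²(μ)` (iterated integrals are product integrals by Fubini); the
hypotheses and conclusions are translated between Bochner squares `∫ f²` and `∫⁻ ‖f‖ₑ²`
(`rcWeakLimit_lintegral_enorm_sq_eq`) and between `uncurry`- and `stLift`-measurability
(`Torus.aestronglyMeasurable_stLift_of_uncurry` / `…_uncurry_of_stLift_prod`). The global bound
`∫ Θ² ≤ C` is weak lower semicontinuity of the norm in the elementary form: testing against `Θ`
itself, `∫ ϑ_{φ₁ n} Θ ≤ (∫ ϑ_{φ₁ n}² + ∫ Θ²)/2 ≤ (C + ∫ Θ²)/2`, and the left side tends to `∫ Θ²`.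
Torus part (`rcWeakLimit_torus`, applied to `ϑ₀ ∘ φ₁`): weak sequential compactness of bounded
sequences in the separable Hilbert space `L²(T²)`
(`Literature.Analysis.FunctionSpaces.exists_strictMono_tendsto_inner_of_norm_le`, Brezis 2011,
Thm. 3.18), exactly as stub F of the condensate theorem
(`Condensate.condensateWeakLimit_exists_subseq`), keeping the norm bound `‖Θ₀‖ ≤ √C₀` of the weak
limit and testing against all of `L²`; the common subsequence is `φ₁ ∘ φ₂` (diagonal extraction for
two sequences).

Not here: any identification of the limits (that is the neighbouring stub RC-LIM).
-/

noncomputable section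

namespace Summit.AnomalousDissipation.AnomalousDissipation.Theorems.TwohalfdNeg.RegularCondensate

open MeasureTheory Filter Topology
open scoped ENNReal NNReal InnerProductSpace
open Literature.Analysis.FunctionSpaces Literature.Analysis.FluidPDE

-- the summit and the problem are both called `AnomalousDissipation` (path-aligned namespace)
set_option linter.dupNamespace false

/-- `∫⁻ ‖f‖ₑ² = ofReal (∫ f²)` for a real function with integrable square (the Bochner / lower
Lebesgue integral dictionary `ofReal_integral_eq_lintegral_ofReal` for the nonnegative function
`f²`, with `‖a‖ₑ² = ofReal (a²)`). General-measure form of the tree's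
`Literature.Analysis.FluidPDE.Torus.lintegral_enorm_sq_eq_ofReal_sq` (torus, `MemLp` hypothesis;
not imported to keep the closure small). [folklore] -/
theorem rcWeakLimit_lintegral_enorm_sq_eq {α : Type*} [MeasurableSpace α] {μ : Measure α}
    {f : α → ℝ} (hf : Integrable (fun x => f x ^ 2) μ) :
    ∫⁻ x, ‖f x‖ₑ ^ 2 ∂μ = ENNReal.ofReal (∫ x, f x ^ 2 ∂μ) := by
  rw [ofReal_integral_eq_lintegral_ofReal hf (Eventually.of_forall fun x => sq_nonneg (f x))]
  exact lintegral_congr fun x => by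
    rw [Real.enorm_eq_ofReal_abs, ← ENNReal.ofReal_pow (abs_nonneg _), sq_abs]

/-- **Weak `L²` compactness on a space–time block, product-measure form.** Let
`μ := (vol|_(0,S)) ⊗ vol` on `ℝ × T²` with `S > 0`, and let `ϑ k : ℝ → T² → ℝ` have `μ`-a.e.
strongly measurable uncurrying, integrable squares with `∫ ϑ_k² dμ ≤ C`, and `∫ ϑ_k(t)² ≤ C₁`
for a.e. `t ∈ (0,S)`. Then along a subsequence `φ` there is `Θ : ℝ → T² → ℝ` with
`uncurry Θ ∈ L²(μ)`,
`∫ Θ² dμ ≤ C`, `∫ Θ(t)² ≤ C₁` for a.e. `t ∈ (0,S)`, and `∫ ϑ_{φ n} G dμ → ∫ Θ G dμ` for every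
`G ∈ L²(μ)`. This is the tree's weak-* compactness in `L^∞(0,S; L²(T²))`
(`Torus.exists_strictMono_weakLimit_of_lintegral_sq_le`, Brezis 2011, Cor. 3.30) read through
Fubini (`integral_prod`) and the `∫ f²` / `∫⁻ ‖f‖ₑ²` dictionary, plus the bound `∫ Θ² ≤ C` from
testing against `Θ` itself: `∫ ϑ_{φ n} Θ ≤ (C + ∫ Θ²)/2` and `∫ ϑ_{φ n} Θ → ∫ Θ²`. [folklore] -/
theorem rcWeakLimit_spaceTime {S C C₁ : ℝ} {ϑ : ℕ → ℝ → UnitAddTorus (Fin 2) → ℝ} (hS : 0 < S)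
    (hm : ∀ k, AEStronglyMeasurable (Function.uncurry (ϑ k))
      (((volume : Measure ℝ).restrict (Set.Ioo 0 S)).prod volume))
    (hi : ∀ k, Integrable (fun p : ℝ × UnitAddTorus (Fin 2) => ϑ k p.1 p.2 ^ 2)
      (((volume : Measure ℝ).restrict (Set.Ioo 0 S)).prod volume))
    (hC : ∀ k,
      ∫ p, ϑ k p.1 p.2 ^ 2 ∂(((volume : Measure ℝ).restrict (Set.Ioo 0 S)).prod volume) ≤ C)
    (hC₁ : ∀ k, ∀ᵐ t ∂(volume.restrict (Set.Ioo 0 S)), ∫ x, ϑ k t x ^ 2 ≤ C₁) :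
    ∃ φ : ℕ → ℕ, StrictMono φ ∧ ∃ Θ : ℝ → UnitAddTorus (Fin 2) → ℝ,
      MemLp (Function.uncurry Θ) 2 (((volume : Measure ℝ).restrict (Set.Ioo 0 S)).prod volume) ∧
      ∫ p, Θ p.1 p.2 ^ 2 ∂(((volume : Measure ℝ).restrict (Set.Ioo 0 S)).prod volume) ≤ C ∧
      (∀ᵐ t ∂(volume.restrict (Set.Ioo 0 S)), ∫ x, Θ t x ^ 2 ≤ C₁) ∧
      ∀ G : ℝ × UnitAddTorus (Fin 2) → ℝ,
        MemLp G 2 (((volume : Measure ℝ).restrict (Set.Ioo 0 S)).prod volume) →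
        Tendsto (fun n => ∫ p, ϑ (φ n) p.1 p.2 * G p
            ∂(((volume : Measure ℝ).restrict (Set.Ioo 0 S)).prod volume)) atTop
          (𝓝 (∫ p, Θ p.1 p.2 * G p
            ∂(((volume : Measure ℝ).restrict (Set.Ioo 0 S)).prod volume))) := by
  set μ : Measure (ℝ × UnitAddTorus (Fin 2)) :=
    ((volume : Measure ℝ).restrict (Set.Ioo 0 S)).prod volume with hμ
  -- `0 ≤ C₁`: the slice bound holds at some time of the non-null interval `(0, S)`
  have hC₁nn : 0 ≤ C₁ := by
    haveI : (ae ((volume : Measure ℝ).restrict (Set.Ioo 0 S))).NeBot := by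
      rw [ae_neBot, Ne, Measure.restrict_eq_zero, Real.volume_Ioo, ENNReal.ofReal_eq_zero, not_le]
      linarith
    obtain ⟨t, ht⟩ := (hC₁ 0).exists
    exact (integral_nonneg fun x => sq_nonneg _).trans ht
  -- the fields in `L²(μ)`
  have hL : ∀ k, MemLp (Function.uncurry (ϑ k)) 2 μ := fun k =>
    (memLp_two_iff_integrable_sq (hm k)).2 (hi k)
  -- hypotheses of the tree's weak-* compactness theorem
  have hm' : ∀ k, AEStronglyMeasurable (Torus.stLift (ϑ k))
      (volume.restrict (Set.Ioo 0 S ×ˢ Set.univ)) := fun k =>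
    Torus.aestronglyMeasurable_stLift_of_uncurry (hm k)
  have hb : ∀ k, ∀ᵐ t ∂(volume.restrict (Set.Ioo 0 S)),
      ∫⁻ x, ‖ϑ k t x‖ₑ ^ 2 ≤ ((C₁.toNNReal : ℝ≥0) : ℝ≥0∞) := by
    intro k
    filter_upwards [hC₁ k, (hi k).prod_right_ae] with t ht hti
    have hti' : Integrable (fun x => ϑ k t x ^ 2) volume := hti
    rw [rcWeakLimit_lintegral_enorm_sq_eq hti']
    exact ENNReal.ofReal_le_ofReal ht
  obtain ⟨φ, hφ, W, hWm, hWb, hWconv⟩ :=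
    Torus.exists_strictMono_weakLimit_of_lintegral_sq_le (T := S) (C := C₁.toNNReal) hm' hb
  have hWm' : AEStronglyMeasurable (Function.uncurry W) μ :=
    Torus.aestronglyMeasurable_uncurry_of_stLift_prod hWm
  -- `W ∈ L²(μ)`: its space–time square integral is at most `C₁ · S`
  have hWfin : ∫⁻ t in Set.Ioo 0 S, ∫⁻ x, ‖W t x‖ₑ ^ 2 < ∞ := by
    calc ∫⁻ t in Set.Ioo 0 S, ∫⁻ x, ‖W t x‖ₑ ^ 2
        ≤ ∫⁻ _ in Set.Ioo 0 S, ((C₁.toNNReal : ℝ≥0) : ℝ≥0∞) := lintegral_mono_ae hWb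
      _ < ∞ := by
        rw [lintegral_const, Measure.restrict_apply_univ, Real.volume_Ioo]
        exact ENNReal.mul_lt_top ENNReal.coe_lt_top ENNReal.ofReal_lt_top
  have hWL : MemLp (Function.uncurry W) 2 μ := (Torus.memLp_two_uncurry hWm' hWfin).1
  -- pairings against `L²(μ)` functions, in product-integral form (Fubini)
  have hconv : ∀ G : ℝ × UnitAddTorus (Fin 2) → ℝ, MemLp G 2 μ →
      Tendsto (fun n => ∫ p, ϑ (φ n) p.1 p.2 * G p ∂μ) atTop (𝓝 (∫ p, W p.1 p.2 * G p ∂μ)) := by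
    intro G hG
    have hGm' : AEStronglyMeasurable (Function.uncurry fun t x => G (t, x)) μ :=
      hG.aestronglyMeasurable
    have hGm : AEStronglyMeasurable (Torus.stLift fun t x => G (t, x))
        (volume.restrict (Set.Ioo 0 S ×ˢ Set.univ)) :=
      Torus.aestronglyMeasurable_stLift_of_uncurry hGm'
    have hGfin : ∫⁻ t in Set.Ioo 0 S, ∫⁻ x, ‖G (t, x)‖ₑ ^ 2 < ∞ := by
      have h1 : ∫⁻ t in Set.Ioo 0 S, ∫⁻ x, ‖G (t, x)‖ₑ ^ 2 = ∫⁻ p, ‖G p‖ₑ ^ 2 ∂μ :=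
        (lintegral_prod (fun p => ‖G p‖ₑ ^ 2)
          (hG.aestronglyMeasurable.aemeasurable.enorm.pow_const 2)).symm
      rw [h1, ← eLpNorm_two_pow_two_eq_lintegral]
      exact ENNReal.pow_lt_top hG.eLpNorm_lt_top
    have h : Tendsto (fun n => ∫ t in Set.Ioo 0 S, ∫ x, ϑ (φ n) t x * G (t, x)) atTop
        (𝓝 (∫ t in Set.Ioo 0 S, ∫ x, W t x * G (t, x))) :=
      hWconv (fun t x => G (t, x)) hGm hGfin
    have e1 : ∀ n, ∫ p, ϑ (φ n) p.1 p.2 * G p ∂μ =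
        ∫ t in Set.Ioo 0 S, ∫ x, ϑ (φ n) t x * G (t, x) := by
      intro n
      have hint : Integrable (fun p : ℝ × UnitAddTorus (Fin 2) => ϑ (φ n) p.1 p.2 * G p) μ :=
        (hL (φ n)).integrable_mul hG
      exact integral_prod _ hint
    have e2 : ∫ p, W p.1 p.2 * G p ∂μ = ∫ t in Set.Ioo 0 S, ∫ x, W t x * G (t, x) := by
      have hint : Integrable (fun p : ℝ × UnitAddTorus (Fin 2) => W p.1 p.2 * G p) μ :=
        hWL.integrable_mul hG
      exact integral_prod _ hint
    rw [e2]
    exact h.congr fun n => (e1 n).symm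
  refine ⟨φ, hφ, W, hWL, ?_, ?_, hconv⟩
  · -- `∫ W² ≤ C`: test against `W` itself and use `ϑ W ≤ (ϑ² + W²) / 2`
    have hWi : Integrable (fun p : ℝ × UnitAddTorus (Fin 2) => W p.1 p.2 ^ 2) μ :=
      (memLp_two_iff_integrable_sq hWm').1 hWL
    have hbound : ∀ n, ∫ p, ϑ (φ n) p.1 p.2 * W p.1 p.2 ∂μ ≤
        (C + ∫ p, W p.1 p.2 ^ 2 ∂μ) / 2 := by
      intro n
      have hint : Integrable (fun p : ℝ × UnitAddTorus (Fin 2) => ϑ (φ n) p.1 p.2 * W p.1 p.2) μ :=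
        (hL (φ n)).integrable_mul hWL
      calc ∫ p, ϑ (φ n) p.1 p.2 * W p.1 p.2 ∂μ
          ≤ ∫ p, (ϑ (φ n) p.1 p.2 ^ 2 + W p.1 p.2 ^ 2) / 2 ∂μ := by
            refine integral_mono hint (((hi (φ n)).add hWi).div_const 2) fun p => ?_
            have h2 := two_mul_le_add_sq (ϑ (φ n) p.1 p.2) (W p.1 p.2)
            dsimp only
            linarith
        _ = ((∫ p, ϑ (φ n) p.1 p.2 ^ 2 ∂μ) + ∫ p, W p.1 p.2 ^ 2 ∂μ) / 2 := by
            rw [integral_div, integral_add (hi (φ n)) hWi]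
        _ ≤ (C + ∫ p, W p.1 p.2 ^ 2 ∂μ) / 2 := by
            gcongr
            exact hC (φ n)
    have hle : ∫ p, W p.1 p.2 * W p.1 p.2 ∂μ ≤ (C + ∫ p, W p.1 p.2 ^ 2 ∂μ) / 2 :=
      le_of_tendsto' (hconv (Function.uncurry W) hWL) hbound
    have hsq : ∫ p, W p.1 p.2 * W p.1 p.2 ∂μ = ∫ p, W p.1 p.2 ^ 2 ∂μ :=
      integral_congr_ae (Eventually.of_forall fun p => (pow_two _).symm)
    rw [hsq] at hle
    linarith
  · -- the slice bound, back in Bochner form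
    filter_upwards [hWb] with t ht
    by_cases hti : Integrable (fun x => W t x ^ 2) volume
    · rw [rcWeakLimit_lintegral_enorm_sq_eq hti] at ht
      exact (ENNReal.ofReal_le_ofReal_iff hC₁nn).1 ht
    · rw [integral_undef hti]
      exact hC₁nn

/-- **Weak limits in `L²(T²)` with the norm bound, tested against all of `L²`.** A sequence `Θ_k`
of square-integrable functions on `T²` with `∫ Θ_k² ≤ C₀` has a subsequence `Θ_{σ n}` and a
square-integrable `Θ'` with `∫ Θ'² ≤ C₀` and `∫ Θ_{σ n} w → ∫ Θ' w` for every `w ∈ L²(T²)` (weak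
sequential compactness of bounded sequences of the separable Hilbert space `L²(T²)` with the bound
`‖Θ'‖ ≤ √C₀` on the weak limit,
`Literature.Analysis.FunctionSpaces.exists_strictMono_tendsto_inner_of_norm_le`, Brezis 2011,
Thm. 3.18; pairings of classes are integrals of products,
`Condensate.condensateWeakLimit_inner_toLp`). Strengthens the condensate theorem's
`Condensate.condensateWeakLimit_exists_subseq` (continuous test functions, no bound). [folklore] -/
theorem rcWeakLimit_torus {C₀ : ℝ} {Θ : ℕ → UnitAddTorus (Fin 2) → ℝ}
    (hΘ : ∀ k, MemLp (Θ k) 2 volume) (hC₀ : ∀ k, ∫ x, Θ k x ^ 2 ≤ C₀) :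
    ∃ σ : ℕ → ℕ, StrictMono σ ∧ ∃ Θ' : UnitAddTorus (Fin 2) → ℝ, MemLp Θ' 2 volume ∧
      ∫ x, Θ' x ^ 2 ≤ C₀ ∧
      ∀ w : UnitAddTorus (Fin 2) → ℝ, MemLp w 2 volume →
        Tendsto (fun n => ∫ x, Θ (σ n) x * w x) atTop (𝓝 (∫ x, Θ' x * w x)) := by
  haveI : Fact ((2 : ℝ≥0∞) ≠ ∞) := ⟨ENNReal.ofNat_ne_top⟩
  haveI : TopologicalSpace.SeparableSpace (Lp ℝ 2 (volume : Measure (UnitAddTorus (Fin 2)))) :=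
    inferInstance
  have hC₀nn : 0 ≤ C₀ := (integral_nonneg fun x => sq_nonneg _).trans (hC₀ 0)
  have hvM : ∀ k, ‖(hΘ k).toLp (Θ k)‖ ≤ Real.sqrt C₀ := fun k =>
    Condensate.condensateWeakLimit_norm_toLp_le (hΘ k) (hC₀ k)
  obtain ⟨σ, hσ, w, hwM, hw⟩ := exists_strictMono_tendsto_inner_of_norm_le hvM
  have hwL : MemLp (w : UnitAddTorus (Fin 2) → ℝ) 2 volume := Lp.memLp w
  have hwto : hwL.toLp (w : UnitAddTorus (Fin 2) → ℝ) = w := Lp.toLp_coeFn w (Lp.memLp w)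
  refine ⟨σ, hσ, (w : UnitAddTorus (Fin 2) → ℝ), hwL, ?_, fun z hz => ?_⟩
  · have e := Condensate.condensateWeakLimit_inner_toLp hwL hwL
    rw [hwto, real_inner_self_eq_norm_sq] at e
    calc ∫ x, (w : UnitAddTorus (Fin 2) → ℝ) x ^ 2
        = ∫ x, (w : UnitAddTorus (Fin 2) → ℝ) x * (w : UnitAddTorus (Fin 2) → ℝ) x :=
          integral_congr_ae (Eventually.of_forall fun x => pow_two _)
      _ = ‖w‖ ^ 2 := e.symm
      _ ≤ Real.sqrt C₀ ^ 2 := pow_le_pow_left₀ (norm_nonneg _) hwM 2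
      _ = C₀ := Real.sq_sqrt hC₀nn
  · have h := hw (hz.toLp z)
    have e1 : ∀ n, inner ℝ ((hΘ (σ n)).toLp (Θ (σ n))) (hz.toLp z) = ∫ x, Θ (σ n) x * z x :=
      fun n => Condensate.condensateWeakLimit_inner_toLp (hΘ (σ n)) hz
    have e2 : inner ℝ w (hz.toLp z) = ∫ x, (w : UnitAddTorus (Fin 2) → ℝ) x * z x := by
      have e := Condensate.condensateWeakLimit_inner_toLp hwL hz
      rwa [hwto] at e
    rw [← e2]
    exact h.congr fun n => e1 n

/-- **RC-WL `stub_rcWeakLimit` — joint weak `L²` compactness on a block.** Bounded sequences in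
`L²((0,S) × T²)` (with a uniform a.e. slice bound) and in `L²(T²)` have, along ONE common
subsequence, weak limits `Θ`, `Θ₀` inheriting the bounds (closed balls are weakly sequentially
closed; the slice bound is tested on `B × T²` for measurable `B ⊆ (0,S)`), with convergence of the
pairings against every bounded measurable space–time function and every `L²` function
respectively. Proof: the space–time
extraction `rcWeakLimit_spaceTime` (a bounded a.e. strongly measurable `G` is in `L²` of the finite
measure `(vol|_(0,S)) ⊗ vol`, `MemLp.of_bound`) followed by the torus extraction `rcWeakLimit_torus`
along the first subsequence; the common subsequence is the composite (Brezis 2011, Thm. 3.18 /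
Cor. 3.30; diagonal subsequence). [folklore] -/
theorem stub_rcWeakLimit :
    ∀ (S C C₀ C₁ : ℝ) (ϑ : ℕ → ℝ → UnitAddTorus (Fin 2) → ℝ) (ϑ₀ : ℕ → UnitAddTorus (Fin 2) → ℝ), 0 < S →
      (∀ k, AEStronglyMeasurable (Function.uncurry (ϑ k))
        (((volume : Measure ℝ).restrict (Set.Ioo 0 S)).prod volume)) →
      (∀ k, Integrable (fun p : ℝ × UnitAddTorus (Fin 2) => ϑ k p.1 p.2 ^ 2)
        (((volume : Measure ℝ).restrict (Set.Ioo 0 S)).prod volume)) →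
      (∀ k, ∫ p, ϑ k p.1 p.2 ^ 2 ∂(((volume : Measure ℝ).restrict (Set.Ioo 0 S)).prod volume) ≤ C) →
      (∀ k, ∀ᵐ t ∂(volume.restrict (Set.Ioo 0 S)), ∫ x, ϑ k t x ^ 2 ≤ C₁) →
      (∀ k, MemLp (ϑ₀ k) 2 volume) → (∀ k, ∫ x, ϑ₀ k x ^ 2 ≤ C₀) →
      ∃ (φ : ℕ → ℕ) (Θ : ℝ → UnitAddTorus (Fin 2) → ℝ) (Θ₀ : UnitAddTorus (Fin 2) → ℝ), StrictMono φ ∧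
        AEStronglyMeasurable (Function.uncurry Θ) (((volume : Measure ℝ).restrict (Set.Ioo 0 S)).prod volume) ∧
        Integrable (fun p : ℝ × UnitAddTorus (Fin 2) => Θ p.1 p.2 ^ 2)
          (((volume : Measure ℝ).restrict (Set.Ioo 0 S)).prod volume) ∧
        ∫ p, Θ p.1 p.2 ^ 2 ∂(((volume : Measure ℝ).restrict (Set.Ioo 0 S)).prod volume) ≤ C ∧
        (∀ᵐ t ∂(volume.restrict (Set.Ioo 0 S)), ∫ x, Θ t x ^ 2 ≤ C₁) ∧
        MemLp Θ₀ 2 volume ∧ ∫ x, Θ₀ x ^ 2 ≤ C₀ ∧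
        (∀ G : ℝ × UnitAddTorus (Fin 2) → ℝ,
          AEStronglyMeasurable G (((volume : Measure ℝ).restrict (Set.Ioo 0 S)).prod volume) →
          (∃ M : ℝ, ∀ p, |G p| ≤ M) →
          Tendsto (fun n => ∫ p, ϑ (φ n) p.1 p.2 * G p ∂(((volume : Measure ℝ).restrict (Set.Ioo 0 S)).prod volume))
            atTop (𝓝 (∫ p, Θ p.1 p.2 * G p ∂(((volume : Measure ℝ).restrict (Set.Ioo 0 S)).prod volume)))) ∧
        (∀ w : UnitAddTorus (Fin 2) → ℝ, MemLp w 2 volume →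
          Tendsto (fun n => ∫ x, ϑ₀ (φ n) x * w x) atTop (𝓝 (∫ x, Θ₀ x * w x))) := by
  intro S C C₀ C₁ ϑ ϑ₀ hS hm hi hC hC₁ hϑ₀ hC₀
  obtain ⟨φ₁, hφ₁, Θ, hΘL, hΘC, hΘC₁, hconv⟩ := rcWeakLimit_spaceTime hS hm hi hC hC₁
  obtain ⟨φ₂, hφ₂, Θ₀, hΘ₀L, hΘ₀C, hconv₀⟩ :=
    rcWeakLimit_torus (Θ := fun k => ϑ₀ (φ₁ k)) (fun k => hϑ₀ (φ₁ k)) fun k => hC₀ (φ₁ k)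
  have hΘi : Integrable (fun p : ℝ × UnitAddTorus (Fin 2) => Θ p.1 p.2 ^ 2)
      (((volume : Measure ℝ).restrict (Set.Ioo 0 S)).prod volume) :=
    (memLp_two_iff_integrable_sq hΘL.aestronglyMeasurable).1 hΘL
  refine ⟨fun n => φ₁ (φ₂ n), Θ, Θ₀, hφ₁.comp hφ₂, hΘL.aestronglyMeasurable, hΘi, hΘC, hΘC₁, hΘ₀L,
    hΘ₀C, fun G hGm hGb => ?_, fun w hw => hconv₀ w hw⟩
  obtain ⟨M, hM⟩ := hGb
  have hGL : MemLp G 2 (((volume : Measure ℝ).restrict (Set.Ioo 0 S)).prod volume) :=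
    MemLp.of_bound hGm M (Eventually.of_forall fun p => (Real.norm_eq_abs (G p)).le.trans (hM p))
  exact (hconv G hGL).comp hφ₂.tendsto_atTop

end Summit.AnomalousDissipation.AnomalousDissipation.Theorems.TwohalfdNeg.RegularCondensate

end
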